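/-
Copyright (c) 2026 the pub-hodgecm-mathlib formalisation cell (harness21).  Prover seat hodgecm-mathlib-LH5-p03 (g2): LH5b «TAMAGAWA-DENSITY», brick (J2α) «CAYLEY WINDOW»
FILE 4 «Ad(q)-EQUIVARIANCE + INTERSECTED ORDER» (LH5-plan (g2) ROUTING 08:5xZ; consumer = (J2-core) assembly, LH4-p02 (g4)); 2026-09-02.
-/
import Literature.NumberTheory.Weil1982.UnitaryFinCayleyWindowIndexGeneral   -- ★ p850620 FILE 3 (this seat): `relIndex_levelOf_eq`, `ballMat_window_stable`; brings ★ FILE 2 p850601, ★ FILE 1 p850554, ★ D1 p850468 (`adMat`, `finLie_conj`, `mat_conj_sub_one`, …)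
import HarnessLib

/-!
# The Cayley window under conjugation: `Ad(q)`-equivariance, transport of `levelOf`, and the intersected order `p·M ∩ Ad(q)(p·M)`

Topic `NumberTheory/Weil1982`; namespace `Literature.NumberTheory.Weil1982.UnitaryFinTopForm` (continues ★ FILES 1–3 `UnitaryFinCayleyWindow*` and ★ D1).  THEOREMS ONLY (no definition,
no instance, no notation, no axiom, no `sorry`); lane `--kind proof --supports stmt-HodgeConjecture-24833`.  Cell `pub/hodgecm-mathlib` (D-0151), crux H413 = `stmt-HodgeConjecture-24833`,
half A line LH5, second layer LH5b «TAMAGAWA-DENSITY» under the PRINT organ O4♮ (LH5-plan (g2) ROUTING 08:5xZ «FILE 4 Ad(q)-EQUIVARIANCE + INTERSECTED ORDER»): the transport half of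
the (J2-core) ORDER-INDEPENDENCE of ★ `tamagawaDensity` for a GENERAL `q ∈ U(H)(L⁺_v)` (not only `q ∈ K_v`, which is ★ D1 §5): `Ad(q)` commutes with the Cayley window, carries
`levelOf x B` to `levelOf (qxq⁻¹) (Ad(q)B)`, and the intersected ball `B = a·M ∩ Ad(q)(a·M)` (LH4-p02 (g4)'s «M″ = M ∩ Ad(q)M», never named as an order) satisfies the two hypotheses
of ★ FILE 3 `relIndex_levelOf_eq` (multiplicatively closed, window-stable).  NOTE: ★ D1 `finLie_conj` is ALREADY stated for every `q ∈ G_v` (LH5-p01 (g2)); not restated here.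
HONEST LABEL: HC_CM is proved only modulo the 7 printed citations (2 remaining named inputs: hLiu418 = `stmt-HodgeConjecture-24832`, h413 = `stmt-HodgeConjecture-24833`) until rung 0
closes; count-neutral junction brick.

* §1 `adMat` algebra: `adMat_one`, `adMat_mul`, `adMat_smul`, `det_adMat`, `adMat_nonsing_inv`, `map_adMat_mul_closed`, `twoBall_map_adMat`;
* §2 equivariance: **`cayley_adMat`** (`c(Ad(q)X) = Ad(q)c(X)`), **`cayleyLocal_adMat`** (`e_{qxq⁻¹}(Ad(q)X) = q·e_x(X)·q⁻¹`);
* §3 **`map_conj_levelOf`**: `(levelOf x B hB).map (conj q) = levelOf (qxq⁻¹) (B.map Ad(q)) _` (★ D1 `levelTwoP_conj` with the `K_v`-hypothesis dropped, any `B`);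
* §4 the intersected ball: **`ballMat_inf_map_adMat_mul_closed`**, **`ballMat_inf_map_adMat_window_stable`** (the `hB`, `hBwin` of ★ `relIndex_levelOf_eq` at `B = a·M ⊓ (a·M).map Ad(q)`).

## References
* [PlatonovRapinchuk1994] V. Platonov, A. Rapinchuk, *Algebraic Groups and Number Theory* (1994), §3.3, §3.5.
* [Weil1982] A. Weil, *Adeles and Algebraic Groups* (1982), Ch. II §2.2.
-/

set_option autoImplicit false

noncomputable section

open NumberField IsDedekindDomain ValuativeRel Matrix
open Literature.NumberTheory.Automorphic Literature.NumberTheory.Automorphic.UnitaryGroup Literature.NumberTheory.Automorphic.UnitaryLatticeTree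
open scoped MatrixGroups Matrix

namespace Literature.NumberTheory.Weil1982.UnitaryFinTopForm

section CM

variable (L : Type) [Field L] [NumberField L] [IsCMField L] (N : ℕ) (H : Matrix (Fin N) (Fin N) L)
  (v : HeightOneSpectrum (𝓞 ↥(maximalRealSubfield L)))

/-! ## §1 `Ad(q)` is a ring automorphism of `M_N(E_v)` -/

/-- `Ad(q) 1 = 1`. [cite: PlatonovRapinchuk1994, §3.3] -/
theorem adMat_one (q : (cmDatum L N H).Local v) : adMat L N H v q 1 = 1 := by
  rw [adMat_apply, Matrix.mul_one, mat_mul_inv]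

/-- `Ad(q)(XY) = Ad(q)X · Ad(q)Y`. [cite: PlatonovRapinchuk1994, §3.3] -/
theorem adMat_mul (q : (cmDatum L N H).Local v) (X Y : Matrix (Fin N) (Fin N) (LocalRing L v)) : adMat L N H v q (X * Y) = adMat L N H v q X * adMat L N H v q Y := by
  rw [adMat_apply, adMat_apply, adMat_apply]
  simp only [Matrix.mul_assoc]
  rw [mat_inv_mul_cancel_left]

/-- `Ad(q)(c·X) = c·Ad(q)X` for a scalar `c ∈ E_v`. [cite: PlatonovRapinchuk1994, §3.3] -/
theorem adMat_smul (q : (cmDatum L N H).Local v) (c : LocalRing L v) (X : Matrix (Fin N) (Fin N) (LocalRing L v)) : adMat L N H v q (c • X) = c • adMat L N H v q X := by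
  rw [adMat_apply, adMat_apply, Matrix.mul_smul, Matrix.smul_mul]

/-- `det Ad(q)Y = det Y`. [cite: PlatonovRapinchuk1994, §3.3] -/
theorem det_adMat (q : (cmDatum L N H).Local v) (Y : Matrix (Fin N) (Fin N) (LocalRing L v)) : (adMat L N H v q Y).det = Y.det := by
  rw [adMat_apply, Matrix.det_mul, Matrix.det_mul]
  calc (mat L N H v q).det * Y.det * (mat L N H v q⁻¹).det = Y.det * ((mat L N H v q).det * (mat L N H v q⁻¹).det) := by ring
    _ = Y.det := by rw [← Matrix.det_mul, mat_mul_inv, Matrix.det_one, mul_one]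

/-- `Ad(q)(Y⁻¹) = (Ad(q)Y)⁻¹` for `det Y` a unit. [cite: PlatonovRapinchuk1994, §3.3] -/
theorem adMat_nonsing_inv (q : (cmDatum L N H).Local v) {Y : Matrix (Fin N) (Fin N) (LocalRing L v)} (hY : IsUnit Y.det) : adMat L N H v q Y⁻¹ = (adMat L N H v q Y)⁻¹ :=
  (Matrix.inv_eq_right_inv (by rw [← adMat_mul, Matrix.mul_nonsing_inv _ hY, adMat_one])).symm

/-- `Ad(q)` maps a multiplicatively closed additive subgroup to a multiplicatively closed one (the closure argument of `levelOf (qxq⁻¹) (B.map Ad(q))`). [cite: PlatonovRapinchuk1994, §3.3] -/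
theorem map_adMat_mul_closed (q : (cmDatum L N H).Local v) {B : AddSubgroup (Matrix (Fin N) (Fin N) (LocalRing L v))} (hB : ∀ X ∈ B, ∀ Y ∈ B, X * Y ∈ B) :
    ∀ X ∈ B.map (adMat L N H v q), ∀ Y ∈ B.map (adMat L N H v q), X * Y ∈ B.map (adMat L N H v q) := by
  rintro _ ⟨X, hX, rfl⟩ _ ⟨Y, hY, rfl⟩
  exact ⟨X * Y, hB X hX Y hY, adMat_mul L N H v q X Y⟩

/-- `2·(Ad(q)B) = Ad(q)(2·B)`. [cite: PlatonovRapinchuk1994, §3.3] -/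
theorem twoBall_map_adMat (q : (cmDatum L N H).Local v) (B : AddSubgroup (Matrix (Fin N) (Fin N) (LocalRing L v))) :
    twoBall L N v (B.map (adMat L N H v q)) = (twoBall L N v B).map (adMat L N H v q) := by
  rw [twoBall, twoBall, AddSubgroup.map_map, AddSubgroup.map_map]
  congr 1
  ext X i j
  simp only [AddMonoidHom.coe_comp, Function.comp_apply, DistribSMul.toAddMonoidHom_apply, adMat_smul]

/-! ## §2 The Cayley window commutes with `Ad(q)` -/

/-- **`c(Ad(q)X) = Ad(q)c(X)`** (`det(1 − X)` a unit; `Ad(q)` is a ring automorphism fixing `1`). [cite: PlatonovRapinchuk1994, §3.3] -/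
theorem cayley_adMat (q : (cmDatum L N H).Local v) {X : Matrix (Fin N) (Fin N) (LocalRing L v)} (hX : IsUnit (1 - X).det) : cayley (adMat L N H v q X) = adMat L N H v q (cayley X) := by
  have h1 : 1 - adMat L N H v q X = adMat L N H v q (1 - X) := by rw [map_sub, adMat_one]
  have h2 : 1 + adMat L N H v q X = adMat L N H v q (1 + X) := by rw [map_add, adMat_one]
  rw [cayley_def, cayley_def, h1, h2, ← adMat_nonsing_inv L N H v q hX, ← adMat_mul]

/-- **Equivariance of the window elements: `e_{qxq⁻¹}(Ad(q)X) = q·e_x(X)·q⁻¹`** whenever both sides are defined (`X ∈ 𝔷(x) ∩ a·M`, `Ad(q)X ∈ 𝔷(qxq⁻¹) ∩ a′·M`, `a, a′` small).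
[cite: PlatonovRapinchuk1994, §3.3] -/
theorem cayleyLocal_adMat (q x : (cmDatum L N H).Local v) {a a' : LocalRing L v} (ha : ∀ w, Valued.v (a w) < 1) (ha' : ∀ w, Valued.v (a' w) < 1)
    {X : Matrix (Fin N) (Fin N) (LocalRing L v)} (hX : X ∈ lieBallAt L N H v x a) (hX' : adMat L N H v q X ∈ lieBallAt L N H v (q * x * q⁻¹) a') :
    cayleyLocal L N H v (q * x * q⁻¹) ha' (adMat L N H v q X) hX' = q * cayleyLocal L N H v x ha X hX * q⁻¹ := by
  refine Subtype.ext (Units.ext ?_)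
  change mat L N H v (cayleyLocal L N H v (q * x * q⁻¹) ha' (adMat L N H v q X) hX') = mat L N H v (q * cayleyLocal L N H v x ha X hX * q⁻¹)
  rw [mat_cayleyLocal, mat_mul, mat_mul, mat_cayleyLocal, cayley_adMat L N H v q (isUnit_det_one_sub L N v (valued_apply_lt_one_of_mem_ballMat L N v ha hX.2)), adMat_apply]

/-! ## §3 Transport of the levels under conjugation -/

/-- **`conj_q (levelOf x B) = levelOf (q x q⁻¹) (Ad(q)B)`** for EVERY `q ∈ U(H)(L⁺_v)` and every multiplicatively closed `B` (★ D1 `levelTwoP_conj` is the case `B = p·M`, `q ∈ K_v`, where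
`Ad(q)(p·M) = p·M`): `Z(qxq⁻¹) = conj_q Z(x)` (★ `centralizer_conj_eq_map`), `mat(q⁻¹gq) − 1 = Ad(q⁻¹)(mat g − 1)` (★ `mat_conj_sub_one`), `2·Ad(q)B = Ad(q)(2·B)`.
[cite: PlatonovRapinchuk1994, §3.3] -/
theorem map_conj_levelOf (q x : (cmDatum L N H).Local v) (B : AddSubgroup (Matrix (Fin N) (Fin N) (LocalRing L v))) (hB : ∀ X ∈ B, ∀ Y ∈ B, X * Y ∈ B) :
    (levelOf L N H v x B hB).map (MulAut.conj q).toMonoidHom = levelOf L N H v (q * x * q⁻¹) (B.map (adMat L N H v q)) (map_adMat_mul_closed L N H v q hB) := by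
  ext g
  have e : (q⁻¹ * g * q)⁻¹ = q⁻¹ * g⁻¹ * q := by group
  rw [Subgroup.mem_map_equiv, MulAut.conj_symm_apply, mem_levelOf_iff, mem_levelOf_iff, mat_conj_sub_one, e, mat_conj_sub_one, twoBall_map_adMat, mem_map_adMat_iff,
    mem_map_adMat_iff, centralizer_conj_eq_map, Subgroup.mem_map_equiv, MulAut.conj_symm_apply]

/-! ## §4 The intersected ball `a·M ∩ Ad(q)(a·M)` satisfies the hypotheses of `relIndex_levelOf_eq` -/

/-- **The intersected ball is multiplicatively closed** (`a ∈ 𝒪`): `X, Y ∈ a·M ∩ Ad(q)(a·M) ⇒ XY ∈ a·M ∩ Ad(q)(a·M)` (`Ad(q⁻¹)(XY) = Ad(q⁻¹)X · Ad(q⁻¹)Y`).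
[cite: PlatonovRapinchuk1994, §3.3] -/
theorem ballMat_inf_map_adMat_mul_closed (q : (cmDatum L N H).Local v) {a : LocalRing L v} (haO : a ∈ localIntegers L v) :
    ∀ X ∈ ballMat L N v a ⊓ (ballMat L N v a).map (adMat L N H v q), ∀ Y ∈ ballMat L N v a ⊓ (ballMat L N v a).map (adMat L N H v q),
      X * Y ∈ ballMat L N v a ⊓ (ballMat L N v a).map (adMat L N H v q) := by
  intro X hX Y hY
  obtain ⟨hX1, hX2⟩ := AddSubgroup.mem_inf.1 hX
  obtain ⟨hY1, hY2⟩ := AddSubgroup.mem_inf.1 hY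
  rw [mem_map_adMat_iff] at hX2 hY2
  refine AddSubgroup.mem_inf.2 ⟨mul_mem_ballMat L N v haO hX1 hY1, ?_⟩
  rw [mem_map_adMat_iff, adMat_mul]
  exact mul_mem_ballMat L N v haO hX2 hY2

/-- **The intersected ball is window-stable** (`a` small): `X ∈ a·M ∩ Ad(q)(a·M) ⇒ X(1−X)⁻¹ ∈ a·M ∩ Ad(q)(a·M)` — on the second factor `Ad(q⁻¹)(X(1−X)⁻¹) = X′(1−X′)⁻¹` with `X′ = Ad(q⁻¹)X ∈ a·M`
(★ FILE 3 `ballMat_window_stable`). [cite: PlatonovRapinchuk1994, §3.3] -/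
theorem ballMat_inf_map_adMat_window_stable (q : (cmDatum L N H).Local v) {a : LocalRing L v} (ha : ∀ w, Valued.v (a w) < 1) :
    ∀ X ∈ ballMat L N v a ⊓ (ballMat L N v a).map (adMat L N H v q), X * (1 - X)⁻¹ ∈ ballMat L N v a ⊓ (ballMat L N v a).map (adMat L N H v q) := by
  intro X hX
  obtain ⟨hX1, hX2⟩ := AddSubgroup.mem_inf.1 hX
  rw [mem_map_adMat_iff] at hX2
  refine AddSubgroup.mem_inf.2 ⟨ballMat_window_stable L N v ha X hX1, ?_⟩
  have hu : IsUnit (1 - X).det := isUnit_det_one_sub L N v (valued_apply_lt_one_of_mem_ballMat L N v ha hX1)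
  rw [mem_map_adMat_iff, adMat_mul, adMat_nonsing_inv L N H v q⁻¹ hu, map_sub, adMat_one]
  exact ballMat_window_stable L N v ha _ hX2

/-- The intersected ball sits inside `a·M` (the `hBa` of ★ `relIndex_levelOf_eq`). [cite: PlatonovRapinchuk1994, §3.3] -/
theorem ballMat_inf_map_adMat_le (q : (cmDatum L N H).Local v) (a : LocalRing L v) : ballMat L N v a ⊓ (ballMat L N v a).map (adMat L N H v q) ≤ ballMat L N v a :=
  inf_le_left

end CM

end Literature.NumberTheory.Weil1982.UnitaryFinTopForm

end
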